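import Literature.NumberTheory.Automorphic.ArchSmallCellFirstOrderStep
import HarnessLib

/-!
# The second-order step of the small-cell analysis: the pair projection, the Casimir symbol, and the vanishing
# across the relevant locus

[cite: Shalika1974, §2, Thm. 2.1]; [cite: Knapp1986, Ch. VIII §3]; [cite: HormanderALPDO1, Thm. 2.3.5];
[cite: Shalika1973, §5, footnote 5 (p. 460)].

Step 3 of Shalika's small-cell analysis on `GL_n(K_∞)` (J. A. Shalika, *The multiplicity one theorem for
`GL_n`*, Ann. of Math. 100 (1974), §2, under the Casimir hypothesis of Shalika (1973), fn. 5) handles the points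
of a small cell `B P_σ B` (at the place `v`) where the first-order datum of an adjacent bad pair of type 4 vanishes,
i.e. where the torus coordinates satisfy `(a_{p₀})_v = (a_{p₁})_v`.  There the Casimir operator of the place `v`
(`ArchWhittakerCasimirEigendistribution`, right form `ArchCasimirInvolution`) is used through the abstract
second-order descent `Literature.Analysis.Distribution.vanish_near_of_secondOrder` (Hörmander, Thm. 2.3.5):

* §1 the **pair projection** `relProj v σ p₀ p₁ (δ₁, δ_a, δ₂) = (π''_v δ₁, (1_v (δ_{a,p₀} - δ_{a,p₁})) e_{p₀}, 0)`,
  a continuous idempotent whose zero set in the cell is `{(a_{p₀})_v = (a_{p₁})_v}`;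
* §2 the **Casimir operator of the place in the chart**: a uniform expansion
  `Ω_v = Σ_{ij} Σ_{st} c_s c_t R_{E_{ij} ε_s} R_{E_{ji} ε_t}` (`ε = placeUnit v`, `c = casCoef v`: `(1, 0)` at a
  real place, `(1, -i)` at a complex place, i.e. `Ω_w` resp. `Ω^{hol}_w`), its eigenvalue on `T ∘ λ(ẇ)`, and the
  equation `E (Σ c_s c_t R R g) = λ E g` for `E = cellPull (T ∘ λ(ẇ))`;
* §3 the torus component of `R_X` at `e₀ = (0, a, 0)` and the **symbol on the torus covector**
  `η = Re ∘ (·)_v ∘ (δ_a)_{p₀}`: `qForm = 2 ((a_{p₀})_v)² ≠ 0`;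
* §4 **second-order vanishing at `e₀ = (0, a, 0)`** (`cellPull_leftTranslate_vanish_near_secondOrder`): if `E`
  vanishes near the nearby points off `{π''_v X₁ = 0, (a_{p₀})_v = (a_{p₁})_v}` then `E` vanishes near `e₀`;
* §5 the same at a general point of an adapted chart (`vanishesNearAt_of_secondOrder`), by the translations of
  `ArchSmallCellFirstOrderStep`;
* §6 **the second-order step on the group** (`archVanishesNear_of_secondOrder`), chart-independently.

Everything is proved; no new facts.
-/

noncomputable section

open NumberField NumberField.InfinitePlace NumberField.mixedEmbedding Set Filter Matrix Complex
open Literature.Analysis.Distribution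
open scoped MatrixGroups Topology Classical ContDiff Matrix.Norms.Operator ComplexConjugate

namespace Literature.NumberTheory.Automorphic

set_option backward.isDefEq.respectTransparency false

variable {n : ℕ} {K : Type} [Field K] [NumberField K]

local notation "R∞" => mixedSpace K
local notation "Mat" => Matrix (Fin n) (Fin n) (mixedSpace K)
local notation "G∞" => GL (Fin n) (mixedSpace K)
local notation "E∞" => CellParam n (mixedSpace K)
local notation "w₀" => ((weylLong n (mixedSpace K) : GL (Fin n) (mixedSpace K)) : Matrix (Fin n) (Fin n) (mixedSpace K))

/-- `M_n(K_∞)` is finite-dimensional over `ℝ` (local instance, as in `ArchBigCellDerivatives`). [folklore] -/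
private theorem finiteDimensional_matrix_mixedSpace_sd : FiniteDimensional ℝ (Matrix (Fin n) (Fin n) (mixedSpace K)) :=
  Module.Finite.matrix

attribute [local instance] finiteDimensional_matrix_mixedSpace_sd

/-- The parameter space is finite-dimensional over `ℝ` (local instance). [folklore] -/
private theorem finiteDimensional_cellParam_sd : FiniteDimensional ℝ (CellParam n (mixedSpace K)) := by
  unfold CellParam; infer_instance

attribute [local instance] finiteDimensional_cellParam_sd

/-! ### 1. The pair projection -/

section PairProj

variable (v : PlaceIdx K) (σ : Equiv.Perm (Fin n)) (p₀ p₁ : Fin n)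

omit [NumberField K] in
/-- **The torus pair functional** `ℓ(δ_a) = 1_v (δ_{a,p₀} - δ_{a,p₁})`. [folklore] -/
def torusPairFn (v : PlaceIdx K) (p₀ p₁ : Fin n) (d : Fin n → R∞) : R∞ := (placeIdem v : R∞) * (d p₀ - d p₁)

omit [NumberField K] in
/-- `ℓ` is additive. [folklore] -/
theorem torusPairFn_add (d d' : Fin n → R∞) : torusPairFn v p₀ p₁ (d + d') = torusPairFn v p₀ p₁ d + torusPairFn v p₀ p₁ d' := by
  simp only [torusPairFn, Pi.add_apply]; ring

omit [NumberField K] in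
/-- `ℓ` is `ℝ`-homogeneous. [folklore] -/
theorem torusPairFn_smul (c : ℝ) (d : Fin n → R∞) : torusPairFn v p₀ p₁ (c • d) = c • torusPairFn v p₀ p₁ d := by
  simp only [torusPairFn, Pi.smul_apply, ← smul_sub, mul_smul_comm]

omit [NumberField K] in
/-- `ℓ (c e_{p₀}) = 1_v c` for `p₀ ≠ p₁`. [folklore] -/
theorem torusPairFn_single (hp : p₀ ≠ p₁) (c : R∞) : torusPairFn v p₀ p₁ (Pi.single p₀ c) = (placeIdem v : R∞) * c := by
  rw [torusPairFn, Pi.single_eq_same, Pi.single_eq_of_ne (Ne.symm hp), sub_zero]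

omit [NumberField K] in
/-- `ℓ = 0` iff `(d_{p₀})_v = (d_{p₁})_v`. [folklore] -/
theorem torusPairFn_eq_zero_iff (d : Fin n → R∞) : torusPairFn v p₀ p₁ d = 0 ↔ placeEmbC v (d p₀) = placeEmbC v (d p₁) := by
  rw [torusPairFn, placeIdem_mul_eq_zero_iff, map_sub, sub_eq_zero]

/-- The pair projection as a linear map. [folklore] -/
def relProjLin (v : PlaceIdx K) (σ : Equiv.Perm (Fin n)) (p₀ p₁ : Fin n) : E∞ →ₗ[ℝ] E∞ where
  toFun e := (piBadLin v σ e.1, Pi.single p₀ (torusPairFn v p₀ p₁ e.2.1), 0)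
  map_add' e e' := by
    simp only [Prod.fst_add, map_add, Prod.snd_add, torusPairFn_add, Pi.single_add, Prod.mk_add_mk, add_zero]
  map_smul' c e := by
    simp only [Prod.smul_fst, map_smul, Prod.smul_snd, torusPairFn_smul, Pi.single_smul, RingHom.id_apply, Prod.smul_mk, smul_zero]

/-- **The pair projection** `(δ₁, δ_a, δ₂) ↦ (π''_v δ₁, ℓ(δ_a) e_{p₀}, 0)`, a continuous linear map. [folklore] -/
def relProj (v : PlaceIdx K) (σ : Equiv.Perm (Fin n)) (p₀ p₁ : Fin n) : E∞ →L[ℝ] E∞ :=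
  LinearMap.toContinuousLinearMap (relProjLin v σ p₀ p₁)

/-- Unfolding `relProj`. [folklore] -/
theorem relProj_apply (e : E∞) :
    relProj v σ p₀ p₁ e = (piBadLin v σ e.1, Pi.single p₀ (torusPairFn v p₀ p₁ e.2.1), 0) := rfl

/-- The first component of `relProj`. [folklore] -/
@[simp] theorem relProj_fst (e : E∞) : ((relProj v σ p₀ p₁ e).1 : Mat) = piBad v σ (e.1 : Mat) := rfl

/-- The torus component of `relProj`. [folklore] -/
@[simp] theorem relProj_snd_fst (e : E∞) : (relProj v σ p₀ p₁ e).2.1 = Pi.single p₀ (torusPairFn v p₀ p₁ e.2.1) := rfl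

/-- The third component of `relProj` vanishes. [folklore] -/
@[simp] theorem relProj_snd_snd (e : E∞) : (relProj v σ p₀ p₁ e).2.2 = 0 := rfl

/-- **`relProj` is idempotent** (`p₀ ≠ p₁`). [folklore] -/
theorem relProj_relProj (hp : p₀ ≠ p₁) (e : E∞) : relProj v σ p₀ p₁ (relProj v σ p₀ p₁ e) = relProj v σ p₀ p₁ e := by
  refine Prod.ext (Subtype.ext ?_) (Prod.ext ?_ rfl)
  · simp only [relProj_fst, piBad_piBad]
  · rw [relProj_snd_fst, relProj_snd_fst, torusPairFn_single v p₀ p₁ hp, torusPairFn, ← mul_assoc, placeIdem_mul_self]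

/-- **The zero set of `relProj`**: `π''_v δ₁ = 0` and `(δ_{a,p₀})_v = (δ_{a,p₁})_v`. [folklore] -/
theorem relProj_eq_zero_iff (e : E∞) :
    relProj v σ p₀ p₁ e = 0 ↔ piBad v σ (e.1 : Mat) = 0 ∧ placeEmbC v (e.2.1 p₀) = placeEmbC v (e.2.1 p₁) := by
  rw [relProj_apply, Prod.mk_eq_zero, Prod.mk_eq_zero, ← torusPairFn_eq_zero_iff]
  simp only [and_true]
  constructor
  · rintro ⟨h1, h2⟩
    refine ⟨?_, ?_⟩
    · have := congrArg Subtype.val h1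
      exact this
    · have := congr_fun h2 p₀
      rwa [Pi.single_eq_same] at this
  · rintro ⟨h1, h2⟩
    exact ⟨Subtype.ext h1, by rw [h2, Pi.single_zero]⟩

end PairProj

/-! ### 2. The Casimir operator of a place in the chart -/

section Casimir

variable (v : PlaceIdx K)

omit [NumberField K] in
/-- **The coefficients of the uniform expansion of `Ω_v`**: `(1, 0)` at a real place (`Ω_w = Σ R_{E_{ij}} R_{E_{ji}}`),
`(1, -i)` at a complex place (`Ω^{hol}_w = Σ (R_{E_{ij} c} - i R_{E_{ij} ic})(R_{E_{ji} c} - i R_{E_{ji} ic})`).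
[cite: Knapp1986, Ch. VIII §3] -/
def casCoef (v : PlaceIdx K) (s : Fin 2) : ℂ :=
  match v with
  | Sum.inl _ => if s = 0 then 1 else 0
  | Sum.inr _ => if s = 0 then 1 else -Complex.I

/-- **The Casimir operator of the place `v` on test functions** (right form): `Ω_w` for a real place,
`Ω^{hol}_w` for a complex place. [cite: Knapp1986, Ch. VIII §3] -/
def placeCasimirR (v : PlaceIdx K) : ↥(archTestFunctions n K) →ₗ[ℂ] ↥(archTestFunctions n K) :=
  match v with
  | Sum.inl w => archTestFunctions.placeCasimirRealR w
  | Sum.inr w => archTestFunctions.placeCasimirHolR w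

/-- **The uniform expansion** `Ω_v F = Σ_{ij} Σ_{st} (c_s c_t) R_{E_{ij} ε_s} (R_{E_{ji} ε_t} F)`. [cite: Knapp1986, Ch. VIII §3] -/
theorem placeCasimirR_apply (F : ↥(archTestFunctions n K)) :
    placeCasimirR v F = ∑ ij : Fin n × Fin n, ∑ st : Fin 2 × Fin 2, (casCoef v st.1 * casCoef v st.2) •
      archTestFunctions.rightDeriv (Matrix.single ij.1 ij.2 (placeUnit v st.1))
        (archTestFunctions.rightDeriv (Matrix.single ij.2 ij.1 (placeUnit v st.2)) F) := by
  rcases v with w | w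
  · simp only [placeCasimirR, archTestFunctions.placeCasimirRealR, LinearMap.sum_apply, LinearMap.comp_apply, Fintype.sum_prod_type,
      Fin.sum_univ_two, casCoef, Fin.isValue, if_true, one_ne_zero, if_false, mul_one, mul_zero, one_smul, zero_smul,
      add_zero]
    rfl
  · simp only [placeCasimirR, archTestFunctions.placeCasimirHolR, LinearMap.sum_apply, LinearMap.comp_apply, Fintype.sum_prod_type,
      Fin.sum_univ_two, casCoef, Fin.isValue, if_true, one_ne_zero, if_false, mul_one, one_mul]
    refine Finset.sum_congr rfl fun i _ => Finset.sum_congr rfl fun j _ => ?_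
    have hu0 : placeUnit (Sum.inr w : PlaceIdx K) 0 = ((0, Pi.single w 1) : mixedSpace K) := rfl
    have hu1 : placeUnit (Sum.inr w : PlaceIdx K) 1 = ((0, Pi.single w Complex.I) : mixedSpace K) := rfl
    rw [hu0, hu1]
    simp only [archTestFunctions.holDerivR, LinearMap.sub_apply, LinearMap.smul_apply, map_sub, map_smul]
    module

/-- **`T ∘ λ(ẇ)` is an eigendistribution of `Ω_v`** for a Casimir eigendistribution `T`. [cite: Shalika1973, §5, footnote 5 (p. 460)] -/
theorem exists_eigenvalue_placeCasimirR {T : ↥(archTestFunctions n K) →ₗ[ℂ] ℂ} (hC : IsArchCasimirEigendistribution n K T) (w : G∞) :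
    ∃ c : ℂ, ∀ F : ↥(archTestFunctions n K), (T.comp (archTestFunctions.leftTranslate w)) (placeCasimirR v F) =
      c * (T.comp (archTestFunctions.leftTranslate w)) F := by
  obtain ⟨hRe, hHo, -⟩ := hC.comp_leftTranslate w
  rcases v with w' | w'
  · obtain ⟨c, hc⟩ := hRe w'
    refine ⟨c, fun F => ?_⟩
    rw [placeCasimirR, ← archTestFunctions.placeCasimirReal_eq_right]
    exact hc F
  · obtain ⟨c, hc⟩ := hHo w'
    refine ⟨c, fun F => ?_⟩
    rw [placeCasimirR, ← archTestFunctions.placeCasimirHol_eq_right]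
    exact hc F

/-- `cellPull T 0 = 0`. [folklore] -/
theorem cellPull_zero (T : ↥(archTestFunctions n K) →ₗ[ℂ] ℂ) : cellPull T (0 : E∞ → ℂ) = 0 := by
  have h := cellPull_smul T (0 : ℂ) (0 : E∞ → ℂ) IsTestFn.zero (by simp)
  rwa [zero_smul, zero_mul] at h

/-- **Linearity of `cellPull T` on finite combinations of admissible functions.** [folklore] -/
theorem cellPull_finset_sum_smul (T : ↥(archTestFunctions n K) →ₗ[ℂ] ℂ) {ι : Type*} (s : Finset ι) (c : ι → ℂ) (h : ι → E∞ → ℂ)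
    (hh : ∀ i, IsTestFn (h i)) (hW : ∀ i, tsupport (h i) ⊆ cellSource n R∞) :
    cellPull T (∑ i ∈ s, c i • h i) = ∑ i ∈ s, c i * cellPull T (h i) := by
  classical
  induction s using Finset.induction_on with
  | empty => simp only [Finset.sum_empty]; exact cellPull_zero T
  | insert a s ha ih =>
    have hsm : ∀ i, IsTestFn (c i • h i) ∧ tsupport (c i • h i) ⊆ cellSource n R∞ := fun i =>
      ⟨(hh i).smul _, (tsupport_smul_subset_right (fun _ : E∞ => c i) (h i)).trans (hW i)⟩
    have hs : IsTestFn (∑ i ∈ s, c i • h i) ∧ tsupport (∑ i ∈ s, c i • h i) ⊆ cellSource n R∞ :=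
      ⟨IsTestFn.finset_sum s fun i _ => (hsm i).1, tsupport_finset_sum_subset s fun i _ => (hsm i).2⟩
    rw [Finset.sum_insert ha, Finset.sum_insert ha, cellPull_add T _ _ (hsm a).1 hs.1 (hsm a).2 hs.2, cellPull_smul T _ _ (hh a) (hW a), ih]

/-- **The Casimir equation in the chart**: `E (Σ_{ij,st} c_s c_t R_{E_ij ε_s}(R_{E_ji ε_t} g)) = λ E g` for
`E = cellPull (T ∘ λ(ẇ))`. [cite: Shalika1974, §2] -/
theorem cellPull_casimir_eq {T : ↥(archTestFunctions n K) →ₗ[ℂ] ℂ} (w : G∞) {c : ℂ}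
    (hc : ∀ F : ↥(archTestFunctions n K), (T.comp (archTestFunctions.leftTranslate w)) (placeCasimirR v F) =
      c * (T.comp (archTestFunctions.leftTranslate w)) F)
    {g : E∞ → ℂ} (hg : IsTestFn g) (hgW : tsupport g ⊆ cellSource n R∞) :
    cellPull (T.comp (archTestFunctions.leftTranslate w))
        (∑ k : (Fin n × Fin n) × (Fin 2 × Fin 2), (casCoef v k.2.1 * casCoef v k.2.2) •
          cellOpR (Matrix.single k.1.1 k.1.2 (placeUnit v k.2.1)) (cellOpR (Matrix.single k.1.2 k.1.1 (placeUnit v k.2.2)) g)) =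
      c * cellPull (T.comp (archTestFunctions.leftTranslate w)) g := by
  have h1 : ∀ k : (Fin n × Fin n) × (Fin 2 × Fin 2), IsTestFn (cellOpR (Matrix.single k.1.2 k.1.1 (placeUnit v k.2.2)) g) ∧
      tsupport (cellOpR (Matrix.single k.1.2 k.1.1 (placeUnit v k.2.2)) g) ⊆ cellSource n R∞ := fun k =>
    ⟨isTestFn_cellOpR _ hg hgW, (tsupport_cellOpR_subset _ g).trans hgW⟩
  have h2 : ∀ k : (Fin n × Fin n) × (Fin 2 × Fin 2),
      IsTestFn (cellOpR (Matrix.single k.1.1 k.1.2 (placeUnit v k.2.1)) (cellOpR (Matrix.single k.1.2 k.1.1 (placeUnit v k.2.2)) g)) ∧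
      tsupport (cellOpR (Matrix.single k.1.1 k.1.2 (placeUnit v k.2.1)) (cellOpR (Matrix.single k.1.2 k.1.1 (placeUnit v k.2.2)) g)) ⊆
        cellSource n R∞ := fun k =>
    ⟨isTestFn_cellOpR _ (h1 k).1 (h1 k).2, (tsupport_cellOpR_subset _ _).trans (h1 k).2⟩
  rw [cellPull_finset_sum_smul _ _ _ _ (fun k => (h2 k).1) (fun k => (h2 k).2)]
  have hpiece : ∀ k : (Fin n × Fin n) × (Fin 2 × Fin 2),
      cellPull (T.comp (archTestFunctions.leftTranslate w))
        (cellOpR (Matrix.single k.1.1 k.1.2 (placeUnit v k.2.1)) (cellOpR (Matrix.single k.1.2 k.1.1 (placeUnit v k.2.2)) g)) =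
      (T.comp (archTestFunctions.leftTranslate w)) (archTestFunctions.rightDeriv (Matrix.single k.1.1 k.1.2 (placeUnit v k.2.1))
        (archTestFunctions.rightDeriv (Matrix.single k.1.2 k.1.1 (placeUnit v k.2.2)) (cellPushFn g ⟨hg, hgW⟩))) := by
    intro k
    rw [cellPull_eq _ (h2 k).1 (h2 k).2, cellPushFn_cellOpR (h1 k).1 (h1 k).2 _ (h2 k).1 (h2 k).2, cellPushFn_cellOpR hg hgW _ (h1 k).1 (h1 k).2]
  simp only [hpiece]
  rw [cellPull_eq _ hg hgW, ← hc, placeCasimirR_apply, map_sum]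
  simp only [map_sum, map_smul, smul_eq_mul, Fintype.sum_prod_type]

end Casimir

/-! ### 3. The torus component of `R_X` at `e₀ = (0, a, 0)` and the symbol on the torus covector -/

section Symbol

variable (v : PlaceIdx K) (σ : Equiv.Perm (Fin n)) (p₀ p₁ : Fin n)

/-- **The torus component of `R_X` at `e₀ = (0, a, 0)` is `(a_i X_{ii})_i`.** [folklore] -/
theorem cellVecR_snd_fst_apply_of_zero {e₀ : E∞} (he₀ : e₀ ∈ cellSource n R∞) (h₁ : e₀.1 = 0) (h₂ : e₀.2.2 = 0) (X : Mat) (i : Fin n) :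
    (cellVecR X e₀).2.1 i = e₀.2.1 i * X i i := by
  rw [cellVecR_eq he₀, cellTangentInv_snd_fst_of_zero he₀ h₁ h₂, cellChart_of_zero h₁ h₂, Matrix.mul_assoc, weylLong_mul_apply, Fin.rev_rev,
    Matrix.diagonal_mul]

/-- **The torus covector** `η(δ) = Re ((δ_{a,p₀})_v)` on the parameter space. [folklore] -/
def torusCovec (v : PlaceIdx K) (p₀ : Fin n) : E∞ →L[ℝ] ℝ :=
  Complex.reCLM.comp (((placeEmbC v).toAddMonoidHom.toRealLinearMap (continuous_placeEmbC v)).comp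
    ((ContinuousLinearMap.proj p₀).comp ((ContinuousLinearMap.fst ℝ (Fin n → R∞) ↥(strictUpperReal n R∞)).comp
      (ContinuousLinearMap.snd ℝ ↥(strictUpperReal n R∞) ((Fin n → R∞) × ↥(strictUpperReal n R∞))))))

/-- Unfolding `torusCovec`. [folklore] -/
@[simp] theorem torusCovec_apply (e : E∞) : torusCovec v p₀ e = (placeEmbC v (e.2.1 p₀)).re := rfl

/-- **`η` on the pair projection of `R_{E_{ij} ε}` at `e₀`**:
`Re((ℓ of the torus component)_v) = Re([i = j = p₀] (a_{p₀} ε)_v - [i = j = p₁] (a_{p₁} ε)_v)`. [folklore] -/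
theorem torusCovec_relProj_cellVecR {e₀ : E∞} (he₀ : e₀ ∈ cellSource n R∞) (h₁ : e₀.1 = 0) (h₂ : e₀.2.2 = 0)
    (i j : Fin n) (x : R∞) :
    torusCovec v p₀ (relProj v σ p₀ p₁ (cellVecR (Matrix.single i j x) e₀)) =
      ((if i = p₀ ∧ j = p₀ then placeEmbC v (e₀.2.1 p₀ * x) else 0) - (if i = p₁ ∧ j = p₁ then placeEmbC v (e₀.2.1 p₁ * x) else 0)).re := by
  rw [torusCovec_apply, relProj_snd_fst, Pi.single_eq_same, torusPairFn, cellVecR_snd_fst_apply_of_zero he₀ h₁ h₂,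
    cellVecR_snd_fst_apply_of_zero he₀ h₁ h₂, placeEmbC_placeIdem_mul, if_pos rfl, map_sub, Matrix.single_apply, Matrix.single_apply]
  congr 2
  · split_ifs <;> simp
  · split_ifs <;> simp

omit [NumberField K] in
/-- `Σ_s c_s Re((x ε_s)_v) = (x)_v` at a complex place and `= (x)_v` (real) at a real place: the uniform coefficients
reconstruct the `v`-component from the real parts. [folklore] -/
theorem sum_casCoef_mul_re (x : R∞) : ∑ s : Fin 2, casCoef v s * (((placeEmbC v (x * placeUnit v s)).re : ℝ) : ℂ) = placeEmbC v x := by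
  rw [Fin.sum_univ_two]
  rcases v with w | w
  · simp [casCoef, placeUnit, placeIdem, placeIdemI]
  · simp only [casCoef, Fin.isValue, if_true, one_ne_zero, if_false, placeUnit, map_mul, placeEmbC_placeIdem, mul_one, placeEmbC_placeIdemI,
      one_mul]
    rw [Complex.mul_I_re]
    apply Complex.ext <;> simp

/-- **The symbol of `Ω_v` on the torus covector at `e₀ = (0, a, 0)`**:
`qForm = Σ_q∈{p₀,p₁} ((a_q)_v)²`-type sum; when `(a_{p₀})_v = (a_{p₁})_v` it equals `2 ((a_{p₀})_v)²`. [cite: Shalika1974, §2] -/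
theorem qForm_casimir_torusCovec {e₀ : E∞} (he₀ : e₀ ∈ cellSource n R∞) (h₁ : e₀.1 = 0) (h₂ : e₀.2.2 = 0) (hp : p₀ ≠ p₁)
    (hrel : placeEmbC v (e₀.2.1 p₀) = placeEmbC v (e₀.2.1 p₁)) (η' : ↥(LinearMap.range (relProj v σ p₀ p₁ : E∞ →ₗ[ℝ] E∞)) →L[ℝ] ℝ)
    (hη' : ∀ b, η' b = torusCovec v p₀ (b : E∞)) :
    qForm (fun k : (Fin n × Fin n) × (Fin 2 × Fin 2) => casCoef v k.2.1 * casCoef v k.2.2)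
      (fun k => (projSplitEquiv (relProj v σ p₀ p₁) (relProj_relProj v σ p₀ p₁ hp) (cellVecR (Matrix.single k.1.1 k.1.2 (placeUnit v k.2.1)) e₀)).1)
      (fun k => (projSplitEquiv (relProj v σ p₀ p₁) (relProj_relProj v σ p₀ p₁ hp) (cellVecR (Matrix.single k.1.2 k.1.1 (placeUnit v k.2.2)) e₀)).1)
      η' = 2 * placeEmbC v (e₀.2.1 p₀) ^ 2 := by
  simp only [qForm, hη', projSplitEquiv_apply_fst, torusCovec_relProj_cellVecR v σ p₀ p₁ he₀ h₁ h₂]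
  -- only the diagonal pairs `(p₀, p₀)` and `(p₁, p₁)` contribute
  rw [Fintype.sum_prod_type]
  have hvan : ∀ ij : Fin n × Fin n, ij ≠ (p₀, p₀) → ij ≠ (p₁, p₁) →
      ∑ st : Fin 2 × Fin 2, casCoef v st.1 * casCoef v st.2 *
        ((((if ij.1 = p₀ ∧ ij.2 = p₀ then placeEmbC v (e₀.2.1 p₀ * placeUnit v st.1) else 0) -
            (if ij.1 = p₁ ∧ ij.2 = p₁ then placeEmbC v (e₀.2.1 p₁ * placeUnit v st.1) else 0)).re : ℝ) : ℂ) *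
        ((((if ij.2 = p₀ ∧ ij.1 = p₀ then placeEmbC v (e₀.2.1 p₀ * placeUnit v st.2) else 0) -
            (if ij.2 = p₁ ∧ ij.1 = p₁ then placeEmbC v (e₀.2.1 p₁ * placeUnit v st.2) else 0)).re : ℝ) : ℂ) = 0 := by
    intro ij h0 h1'
    refine Finset.sum_eq_zero fun st _ => ?_
    have h0' : ¬(ij.1 = p₀ ∧ ij.2 = p₀) := fun h => h0 (Prod.ext h.1 h.2)
    have h1'' : ¬(ij.1 = p₁ ∧ ij.2 = p₁) := fun h => h1' (Prod.ext h.1 h.2)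
    rw [if_neg h0', if_neg h1'']
    simp
  rw [Finset.sum_eq_add_of_mem (p₀, p₀) (p₁, p₁) (Finset.mem_univ _) (Finset.mem_univ _) (fun h => hp (congrArg Prod.fst h))
    (fun ij _ hij => hvan ij hij.1 hij.2)]
  have hp' : ¬(p₁ = p₀) := Ne.symm hp
  simp only [and_self, if_true, hp, hp', if_false, sub_zero, zero_sub, Complex.neg_re, Complex.ofReal_neg, mul_neg, neg_mul, neg_neg]
  -- each diagonal block is `(Σ_s c_s Re((a ε_s)_v))² = ((a)_v)²`
  have hblock : ∀ a : R∞, ∑ st : Fin 2 × Fin 2, casCoef v st.1 * casCoef v st.2 *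
      (((placeEmbC v (a * placeUnit v st.1)).re : ℝ) : ℂ) * (((placeEmbC v (a * placeUnit v st.2)).re : ℝ) : ℂ) = placeEmbC v a ^ 2 := by
    intro a
    rw [sq, ← sum_casCoef_mul_re v a, Finset.sum_mul_sum, Fintype.sum_prod_type]
    refine Finset.sum_congr rfl fun s _ => Finset.sum_congr rfl fun t _ => ?_
    ring
  rw [hblock, hblock, hrel]
  ring

/-- Hence the symbol is non-zero on the cell (the torus coordinates are units). [folklore] -/
theorem qForm_casimir_torusCovec_ne_zero {e₀ : E∞} (he₀ : e₀ ∈ cellSource n R∞) (h₁ : e₀.1 = 0) (h₂ : e₀.2.2 = 0) (hp : p₀ ≠ p₁)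
    (hrel : placeEmbC v (e₀.2.1 p₀) = placeEmbC v (e₀.2.1 p₁)) (η' : ↥(LinearMap.range (relProj v σ p₀ p₁ : E∞ →ₗ[ℝ] E∞)) →L[ℝ] ℝ)
    (hη' : ∀ b, η' b = torusCovec v p₀ (b : E∞)) :
    qForm (fun k : (Fin n × Fin n) × (Fin 2 × Fin 2) => casCoef v k.2.1 * casCoef v k.2.2)
      (fun k => (projSplitEquiv (relProj v σ p₀ p₁) (relProj_relProj v σ p₀ p₁ hp) (cellVecR (Matrix.single k.1.1 k.1.2 (placeUnit v k.2.1)) e₀)).1)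
      (fun k => (projSplitEquiv (relProj v σ p₀ p₁) (relProj_relProj v σ p₀ p₁ hp) (cellVecR (Matrix.single k.1.2 k.1.1 (placeUnit v k.2.2)) e₀)).1)
      η' ≠ 0 := by
  rw [qForm_casimir_torusCovec v σ p₀ p₁ he₀ h₁ h₂ hp hrel η' hη']
  have hunit : placeEmbC v (e₀.2.1 p₀) ≠ 0 := (isUnit_iff_placeEmbC_ne_zero.1 (he₀ p₀)) v
  exact mul_ne_zero two_ne_zero (pow_ne_zero 2 hunit)

/-- The torus covector restricted to the range of the pair projection. [folklore] -/
def torusCovecRange (v : PlaceIdx K) (σ : Equiv.Perm (Fin n)) (p₀ p₁ : Fin n) :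
    ↥(LinearMap.range (relProj v σ p₀ p₁ : E∞ →ₗ[ℝ] E∞)) →L[ℝ] ℝ :=
  (torusCovec v p₀).comp (Submodule.subtypeL _)

/-- Unfolding `torusCovecRange`. [folklore] -/
@[simp] theorem torusCovecRange_apply (b : ↥(LinearMap.range (relProj v σ p₀ p₁ : E∞ →ₗ[ℝ] E∞))) :
    torusCovecRange v σ p₀ p₁ b = torusCovec v p₀ (b : E∞) := rfl

end Symbol

variable (v : PlaceIdx K) (σ : Equiv.Perm (Fin n)) (p₀ p₁ : Fin n)

/-! ### 4. The second-order step at `e₀ = (0, a, 0)` -/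

section Special

/-- The Casimir fields in the chart, cut off: `χ R_{E_{ij} ε_s}`. [folklore] -/
def soField (v : PlaceIdx K) (χ : E∞ → ℝ) (k : (Fin n × Fin n) × (Fin 2 × Fin 2)) (e : E∞) : E∞ :=
  χ e • cellVecR (Matrix.single k.1.1 k.1.2 (placeUnit v k.2.1)) e

/-- The second Casimir fields in the chart, cut off: `χ R_{E_{ji} ε_t}`. [folklore] -/
def soField' (v : PlaceIdx K) (χ : E∞ → ℝ) (k : (Fin n × Fin n) × (Fin 2 × Fin 2)) (e : E∞) : E∞ :=
  χ e • cellVecR (Matrix.single k.1.2 k.1.1 (placeUnit v k.2.2)) e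

set_option maxHeartbeats 1600000 in
set_option synthInstance.maxHeartbeats 400000 in
/-- **Second-order vanishing at a point `e₀ = (0, a, 0)` with `(a_{p₀})_v = (a_{p₁})_v`** (Shalika, §2, via
Hörmander, Thm. 2.3.5): if `E = cellPull (T ∘ λ(ẇ))` vanishes on the test functions supported near `e₀` off
`{π''_v X₁ = 0, (a_{p₀})_v = (a_{p₁})_v}`, then `E` vanishes on the test functions supported near `e₀`.
[cite: Shalika1974, §2, Thm. 2.1] -/
theorem cellPull_leftTranslate_vanish_near_secondOrder {T : ↥(archTestFunctions n K) →ₗ[ℂ] ℂ} (hT : IsArchDistribution n K T)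
    (hC : IsArchCasimirEigendistribution n K T) (τ : PlaceIdx K → Equiv.Perm (Fin n))
    {e₀ : E∞} (he₀ : e₀ ∈ cellSource n R∞) (h₁ : e₀.1 = 0) (h₂ : e₀.2.2 = 0) (hp : p₀ ≠ p₁)
    (hrel : placeEmbC v (e₀.2.1 p₀) = placeEmbC v (e₀.2.1 p₁))
    (hvanE : ∃ V₀ ∈ 𝓝 e₀, ∀ g : E∞ → ℂ, IsTestFn g → tsupport g ⊆ V₀ → (∀ x ∈ tsupport g, relProj v σ p₀ p₁ x ≠ 0) →
      cellPull (T.comp (archTestFunctions.leftTranslate (multiPermGL τ))) g = 0) :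
    ∃ V₁ ∈ 𝓝 e₀, ∀ g : E∞ → ℂ, IsTestFn g → tsupport g ⊆ V₁ →
      cellPull (T.comp (archTestFunctions.leftTranslate (multiPermGL τ))) g = 0 := by
  -- a smooth cutoff `χ = 1` on the ball `W = ball e₀ r ⊆ cellSource`, `tsupport χ ⊆ cellSource`
  obtain ⟨χ, r, hr, hχs, hχsupp, hχ1, hWc⟩ := exists_smooth_cutoff isOpen_cellSource he₀
  have hWo : IsOpen (Metric.ball e₀ r) := Metric.isOpen_ball
  have hx₀ : e₀ ∈ Metric.ball e₀ r := Metric.mem_ball_self hr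
  -- the functional
  have hT' : IsArchDistribution n K (T.comp (archTestFunctions.leftTranslate (multiPermGL τ))) :=
    isArchDistribution_comp_leftTranslate T hT _
  have hlin : IsLocallyLinearOn (Metric.ball e₀ r) (cellPull (T.comp (archTestFunctions.leftTranslate (multiPermGL τ)))) :=
    ⟨fun f g hf hg hfW hgW => cellPull_add _ f g hf hg (hfW.trans hWc) (hgW.trans hWc),
      fun c f hf hfW => cellPull_smul _ c f hf (hfW.trans hWc)⟩
  haveI : Module.Free ℝ E∞ := Module.Free.of_divisionRing ℝ E∞
  have hfin : IsFiniteOrderOn (Metric.ball e₀ r) (cellPull (T.comp (archTestFunctions.leftTranslate (multiPermGL τ)))) :=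
    fun κ hκ hκW => isFiniteOrderOn_cellPull (Module.finBasis ℝ E∞) _ hT' κ hκ (hκW.trans hWc)
  -- the eigenvalue of the Casimir operator of the place
  obtain ⟨lam, hlam⟩ := exists_eigenvalue_placeCasimirR v hC (multiPermGL τ)
  -- the splitting along the pair projection
  have hAfst : ∀ x : E∞, (projSplitEquiv (relProj v σ p₀ p₁) (relProj_relProj v σ p₀ p₁ hp) x).1 = 0 ↔ relProj v σ p₀ p₁ x = 0 :=
    fun x => projSplitEquiv_fst_eq_zero_iff _ x
  have hx₀B : (projSplitEquiv (relProj v σ p₀ p₁) (relProj_relProj v σ p₀ p₁ hp) e₀).1 = 0 := by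
    rw [hAfst, relProj_eq_zero_iff]
    exact ⟨by rw [h₁, ZeroMemClass.coe_zero, piBad_zero], hrel⟩
  -- smoothness of the fields
  have hVs : ∀ k : (Fin n × Fin n) × (Fin 2 × Fin 2), ContDiff ℝ ∞ (soField v χ k) := fun k =>
    contDiff_smul_of_tsupport_subset hχs isOpen_cellSource (contDiffOn_cellVecR _) hχsupp
  have hVs' : ∀ k : (Fin n × Fin n) × (Fin 2 × Fin 2), ContDiff ℝ ∞ (soField' v χ k) := fun k =>
    contDiff_smul_of_tsupport_subset hχs isOpen_cellSource (contDiffOn_cellVecR _) hχsupp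
  have haC : ∀ k : (Fin n × Fin n) × (Fin 2 × Fin 2), ContDiff ℝ ∞ (fun _ : E∞ => casCoef v k.2.1 * casCoef v k.2.2) :=
    fun _ => contDiff_const
  have hbC : ∀ l : Fin 0, ContDiff ℝ ∞ (fun _ : E∞ => (0 : ℂ)) := fun _ => contDiff_const
  have hU : ∀ l : Fin 0, ContDiff ℝ ∞ (fun _ : E∞ => (0 : E∞)) := fun _ => contDiff_const
  have hc0 : ContDiff ℝ ∞ (fun _ : E∞ => (0 : ℂ)) := contDiff_const
  -- the Casimir equation in the chart
  have heq : ∀ g : E∞ → ℂ, IsTestFn g → tsupport g ⊆ Metric.ball e₀ r →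
      cellPull (T.comp (archTestFunctions.leftTranslate (multiPermGL τ)))
        (∑ k : (Fin n × Fin n) × (Fin 2 × Fin 2), (fun _ : E∞ => casCoef v k.2.1 * casCoef v k.2.2) *
            fieldDerivC (soField v χ k) (fieldDerivC (soField' v χ k) g) +
          ∑ l : Fin 0, (fun _ : E∞ => (0 : ℂ)) * fieldDerivC (fun _ : E∞ => (0 : E∞)) g + (fun _ : E∞ => (0 : ℂ)) * g) =
      lam * cellPull (T.comp (archTestFunctions.leftTranslate (multiPermGL τ))) g := by
    intro g hg hgW
    have hgWc : tsupport g ⊆ cellSource n R∞ := hgW.trans hWc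
    have hinner : ∀ k : (Fin n × Fin n) × (Fin 2 × Fin 2), fieldDerivC (soField' v χ k) g =
        cellOpR (Matrix.single k.1.2 k.1.1 (placeUnit v k.2.2)) g := fun k => by
      change fieldDerivC _ g = fieldDerivC (cellVecR (Matrix.single k.1.2 k.1.1 (placeUnit v k.2.2))) g
      refine fieldDerivC_congr_of_eqOn fun x hx => ?_
      simp only [soField', hχ1 x (hgW hx), one_smul]
    have houter : ∀ k : (Fin n × Fin n) × (Fin 2 × Fin 2), fieldDerivC (soField v χ k) (cellOpR (Matrix.single k.1.2 k.1.1 (placeUnit v k.2.2)) g) =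
        cellOpR (Matrix.single k.1.1 k.1.2 (placeUnit v k.2.1)) (cellOpR (Matrix.single k.1.2 k.1.1 (placeUnit v k.2.2)) g) := fun k => by
      change fieldDerivC _ _ = fieldDerivC (cellVecR (Matrix.single k.1.1 k.1.2 (placeUnit v k.2.1))) _
      refine fieldDerivC_congr_of_eqOn fun x hx => ?_
      simp only [soField, hχ1 x (hgW (tsupport_cellOpR_subset _ g hx)), one_smul]
    have hz : (fun _ : E∞ => (0 : ℂ)) * g = 0 := by funext x; simp
    have hfun : (∑ k : (Fin n × Fin n) × (Fin 2 × Fin 2), (fun _ : E∞ => casCoef v k.2.1 * casCoef v k.2.2) *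
          fieldDerivC (soField v χ k) (fieldDerivC (soField' v χ k) g) +
        ∑ l : Fin 0, (fun _ : E∞ => (0 : ℂ)) * fieldDerivC (fun _ : E∞ => (0 : E∞)) g + (fun _ : E∞ => (0 : ℂ)) * g) =
        ∑ k : (Fin n × Fin n) × (Fin 2 × Fin 2), (casCoef v k.2.1 * casCoef v k.2.2) •
          cellOpR (Matrix.single k.1.1 k.1.2 (placeUnit v k.2.1)) (cellOpR (Matrix.single k.1.2 k.1.1 (placeUnit v k.2.2)) g) := by
      have hz0 : (∑ l : Fin 0, (fun _ : E∞ => (0 : ℂ)) * fieldDerivC (fun _ : E∞ => (0 : E∞)) g) = 0 := Fintype.sum_empty _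
      rw [hz0, add_zero, hz, add_zero]
      refine Finset.sum_congr rfl fun k _ => ?_
      rw [hinner, houter]
      funext x
      simp [Pi.mul_apply, Pi.smul_apply, smul_eq_mul]
    rw [hfun]
    exact cellPull_casimir_eq v (multiPermGL τ) hlam hg hgWc
  -- the symbol on the torus covector
  have hη : qForm (fun k : (Fin n × Fin n) × (Fin 2 × Fin 2) => (fun _ : E∞ => casCoef v k.2.1 * casCoef v k.2.2) e₀)
      (fun k => (projSplitEquiv (relProj v σ p₀ p₁) (relProj_relProj v σ p₀ p₁ hp) (soField v χ k e₀)).1)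
      (fun k => (projSplitEquiv (relProj v σ p₀ p₁) (relProj_relProj v σ p₀ p₁ hp) (soField' v χ k e₀)).1)
      (torusCovecRange v σ p₀ p₁) ≠ 0 := by
    have key := qForm_casimir_torusCovec_ne_zero v σ p₀ p₁ he₀ h₁ h₂ hp hrel _ (torusCovecRange_apply v σ p₀ p₁)
    simp only [soField, soField', hχ1 e₀ hx₀, one_smul]
    exact key
  -- vanishing off the locus
  have hvanE' : ∃ V₀ ∈ 𝓝 e₀, ∀ g : E∞ → ℂ, IsTestFn g → tsupport g ⊆ V₀ →
      (∀ x ∈ tsupport g, (projSplitEquiv (relProj v σ p₀ p₁) (relProj_relProj v σ p₀ p₁ hp) x).1 ≠ 0) →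
      cellPull (T.comp (archTestFunctions.leftTranslate (multiPermGL τ))) g = 0 := by
    obtain ⟨V₀, hV₀, hV⟩ := hvanE
    exact ⟨V₀, hV₀, fun g hg hgV hgA => hV g hg hgV fun x hx hPx => hgA x hx ((hAfst x).2 hPx)⟩
  exact vanish_near_of_secondOrder (projSplitEquiv (relProj v σ p₀ p₁) (relProj_relProj v σ p₀ p₁ hp)) hlin hfin hWo
    haC hVs hVs' hbC hU hc0 heq hx₀ hx₀B hη hvanE'

end Special

/-! ### 5. The second-order step at a general point of an adapted chart -/

section General

/-- **The locus `{π''_v X₁ = 0, (a_{p₀})_v = (a_{p₁})_v}` is stable under the translations `paramHomeo m u`**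
(`ẇ m = u₁ ẇ`). [folklore] -/
theorem relProj_paramHomeo_eq_zero_iff {τ : PlaceIdx K → Equiv.Perm (Fin n)} (hτ : τ v = Fin.revPerm * σ)
    (m u u₁ : ↥(upperUnitriangular (Fin n) R∞)) (hmu : (multiPermGL τ : G∞) * (m : G∞) = (u₁ : G∞) * multiPermGL τ)
    {x : E∞} (hx : x ∈ cellSource n R∞) :
    relProj v σ p₀ p₁ (paramHomeo m u x) = 0 ↔ relProj v σ p₀ p₁ x = 0 := by
  rw [relProj_eq_zero_iff, relProj_eq_zero_iff, piBad_paramHomeo_eq_zero_iff v σ hτ m u u₁ hmu hx]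
  rfl

set_option maxHeartbeats 800000 in
/-- **The second-order step at a general point of an adapted chart.** [cite: Shalika1974, §2, Thm. 2.1] -/
theorem vanishesNearAt_of_secondOrder {T : ↥(archTestFunctions n K) →ₗ[ℂ] ℂ} (hT : IsArchDistribution n K T)
    (hC : IsArchCasimirEigendistribution n K T)
    (hL : ∀ (u : ↥(upperUnitriangular (Fin n) (mixedSpace K))) (f : ↥(archTestFunctions n K)),
      T (archTestFunctions.leftTranslate (u : G∞) f) = archWhittakerChar n K u * T f)
    (hR : ∀ (u : ↥(upperUnitriangular (Fin n) (mixedSpace K))) (f : ↥(archTestFunctions n K)),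
      T (archTestFunctions.rightTranslate (u : G∞) f) = (archWhittakerChar n K u)⁻¹ * T f)
    {τ : PlaceIdx K → Equiv.Perm (Fin n)} (hτ : τ v = Fin.revPerm * σ)
    {e : E∞} (he : e ∈ cellSource n R∞)
    (hadapt : (multiPermGL τ : G∞) * unitri (e.1 : Mat) e.1.2 * (multiPermGL τ)⁻¹ ∈ upperUnitriangular (Fin n) R∞)
    (hp : p₀ ≠ p₁) (hrel : placeEmbC v (e.2.1 p₀) = placeEmbC v (e.2.1 p₁))
    (hvan : ∃ V₀ ∈ 𝓝 e, ∀ x ∈ V₀, x ∈ cellSource n R∞ → relProj v σ p₀ p₁ x ≠ 0 →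
      VanishesNearAt (cellPull (T.comp (archTestFunctions.leftTranslate (multiPermGL τ)))) x) :
    VanishesNearAt (cellPull (T.comp (archTestFunctions.leftTranslate (multiPermGL τ)))) e := by
  -- the translations
  set mX : ↥(upperUnitriangular (Fin n) R∞) := ⟨unitri (e.1 : Mat) e.1.2, unitri_mem_upperUnitriangular _ _⟩ with hmX
  set uX : ↥(upperUnitriangular (Fin n) R∞) := ⟨unitri (e.2.2 : Mat) e.2.2.2, unitri_mem_upperUnitriangular _ _⟩ with huX
  set U : ↥(upperUnitriangular (Fin n) R∞) := ⟨(multiPermGL τ : G∞) * unitri (e.1 : Mat) e.1.2 * (multiPermGL τ)⁻¹, hadapt⟩ with hU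
  have hmu : (multiPermGL τ : G∞) * ((mX⁻¹ : ↥(upperUnitriangular (Fin n) R∞)) : G∞) =
      ((U⁻¹ : ↥(upperUnitriangular (Fin n) R∞)) : G∞) * multiPermGL τ := by
    simp only [Subgroup.coe_inv, hmX, hU]
    group
  have hmu' : (multiPermGL τ : G∞) * ((mX⁻¹⁻¹ : ↥(upperUnitriangular (Fin n) R∞)) : G∞) =
      ((U⁻¹⁻¹ : ↥(upperUnitriangular (Fin n) R∞)) : G∞) * multiPermGL τ := by
    simp only [inv_inv, hmX, hU]
    group
  set Φ : E∞ ≃ₜ E∞ := paramHomeo mX⁻¹ uX⁻¹ with hΦ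
  have hΦe : Φ e = cellBasePoint e := paramHomeo_apply_eq_cellBasePoint e
  have he₀ : cellBasePoint e ∈ cellSource n R∞ := cellBasePoint_mem_cellSource he
  -- quasi-invariance along `Φ` and `Φ⁻¹`
  have hqΦ : ∀ h : E∞ → ℂ, IsTestFn h → tsupport h ⊆ cellSource n R∞ →
      cellPull (T.comp (archTestFunctions.leftTranslate (multiPermGL τ))) (h ∘ Φ) =
        ((archWhittakerChar n K uX⁻¹)⁻¹ * (archWhittakerChar n K U⁻¹)⁻¹) *
          cellPull (T.comp (archTestFunctions.leftTranslate (multiPermGL τ))) h :=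
    fun h hh hhW => cellPull_comp_paramHomeo hL hR (multiPermGL τ) mX⁻¹ uX⁻¹ U⁻¹ hmu hh hhW
  have hqΦ' : ∀ h : E∞ → ℂ, IsTestFn h → tsupport h ⊆ cellSource n R∞ →
      cellPull (T.comp (archTestFunctions.leftTranslate (multiPermGL τ))) (h ∘ Φ.symm) =
        ((archWhittakerChar n K uX⁻¹⁻¹)⁻¹ * (archWhittakerChar n K U⁻¹⁻¹)⁻¹) *
          cellPull (T.comp (archTestFunctions.leftTranslate (multiPermGL τ))) h := by
    intro h hh hhW
    have hfun : h ∘ Φ.symm = h ∘ paramHomeo mX⁻¹⁻¹ uX⁻¹⁻¹ := funext fun x => by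
      simp only [Function.comp_apply, hΦ, paramHomeo_symm_eq]
    rw [hfun]
    exact cellPull_comp_paramHomeo hL hR (multiPermGL τ) mX⁻¹⁻¹ uX⁻¹⁻¹ U⁻¹⁻¹ hmu' hh hhW
  -- the vanishing near the base point off the locus, from `hvan` transported along `Φ`
  have hoffbase : ∃ V₀ ∈ 𝓝 (cellBasePoint e), ∀ x ∈ V₀, x ∉ {x : E∞ | relProj v σ p₀ p₁ x = 0} →
      VanishesNearAt (cellPull (T.comp (archTestFunctions.leftTranslate (multiPermGL τ)))) x := by
    obtain ⟨V₀, hV₀, hV⟩ := hvan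
    have hV₀' : Φ.symm ⁻¹' (V₀ ∩ cellSource n R∞) ∈ 𝓝 (cellBasePoint e) := by
      refine Φ.symm.continuous.continuousAt.preimage_mem_nhds ?_
      rw [← hΦe, Φ.symm_apply_apply]
      exact inter_mem hV₀ (isOpen_cellSource.mem_nhds he)
    refine ⟨_, hV₀', fun x hx hxS => ?_⟩
    obtain ⟨hx1, hx2⟩ := hx
    have hoff : relProj v σ p₀ p₁ (Φ.symm x) ≠ 0 := by
      intro h0
      apply hxS
      show relProj v σ p₀ p₁ x = 0
      have h1 := (relProj_paramHomeo_eq_zero_iff v σ p₀ p₁ hτ mX⁻¹ uX⁻¹ U⁻¹ hmu hx2).2 h0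
      rwa [show paramHomeo mX⁻¹ uX⁻¹ (Φ.symm x) = x from Φ.apply_symm_apply x] at h1
    have h2 : VanishesNearAt (cellPull (T.comp (archTestFunctions.leftTranslate (multiPermGL τ)))) (Φ.symm x) := hV _ hx1 hx2 hoff
    exact vanishesNearAt_of_transport Φ.symm (by simpa only [Homeomorph.symm_symm] using contDiff_paramHomeo mX⁻¹ uX⁻¹) hqΦ'
      (e := x) hx2 h2
  have hvanE : ∃ V₀ ∈ 𝓝 (cellBasePoint e), ∀ g : E∞ → ℂ, IsTestFn g → tsupport g ⊆ V₀ → (∀ x ∈ tsupport g, relProj v σ p₀ p₁ x ≠ 0) →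
      cellPull (T.comp (archTestFunctions.leftTranslate (multiPermGL τ))) g = 0 := by
    obtain ⟨V₀, hV₀, h⟩ := exists_nhds_apply_eq_zero_of_forall _ he₀ hoffbase
    exact ⟨V₀, hV₀, fun g hg hgV hgS => h g hg hgV fun x hx => hgS x hx⟩
  -- Step 3 at the base point
  have hbase : VanishesNearAt (cellPull (T.comp (archTestFunctions.leftTranslate (multiPermGL τ)))) (cellBasePoint e) := by
    obtain ⟨V', hV', hE⟩ := cellPull_leftTranslate_vanish_near_secondOrder v σ p₀ p₁ hT hC τ (e₀ := cellBasePoint e) he₀ rfl rfl hp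
      hrel hvanE
    exact ⟨V', hV', hE⟩
  -- transport back to `e`
  exact vanishesNearAt_of_transport Φ (contDiff_paramHomeo_symm mX⁻¹ uX⁻¹) hqΦ (by rw [hΦe]; exact he₀) (by rw [hΦe]; exact hbase)

end General

/-! ### 6. The second-order step on the group -/

section Group

/-- **Off-locus vanishing passes from the group to a chart.** [folklore] -/
theorem exists_nhds_vanishesNearAt_of_group_rel {T : ↥(archTestFunctions n K) →ₗ[ℂ] ℂ} {τ : PlaceIdx K → Equiv.Perm (Fin n)}
    (hτ : τ v = Fin.revPerm * σ) {e : E∞} (he : e ∈ cellSource n R∞)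
    (hoff : ∃ U ∈ 𝓝 (multiPermGL τ * cellChartGL e he), ∀ y' ∈ U,
      (placeGL v y' ∈ bruhatCell (K := ℂ) σ → cellDiag σ (placeGL v y') (σ.symm p₀) ≠ cellDiag σ (placeGL v y') (σ.symm p₁)) →
        ArchVanishesNear T y') :
    ∃ V₀ ∈ 𝓝 e, ∀ x ∈ V₀, x ∈ cellSource n R∞ → relProj v σ p₀ p₁ x ≠ 0 →
      VanishesNearAt (cellPull (T.comp (archTestFunctions.leftTranslate (multiPermGL τ)))) x := by
  obtain ⟨U, hU, hT⟩ := hoff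
  obtain ⟨U', hU'U, hU'o, hxU'⟩ := mem_nhds_iff.1 hU
  have hopen : IsOpen (((↑) : G∞ → Mat) '' U') := (Units.isOpenEmbedding_val (R := Mat)).isOpenMap _ hU'o
  have hcont : Continuous fun e' : E∞ => ((multiPermGL τ : G∞) : Mat) * cellChart e' := continuous_const.mul contDiff_cellChart.continuous
  refine ⟨(fun e' => ((multiPermGL τ : G∞) : Mat) * cellChart e') ⁻¹' (((↑) : G∞ → Mat) '' U'),
    (hopen.preimage hcont).mem_nhds ⟨multiPermGL τ * cellChartGL e he, hxU', by rw [Units.val_mul, coe_cellChartGL]⟩,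
    fun x hx hxs hxb => ?_⟩
  obtain ⟨y', hy'U', hy'⟩ := hx
  have hy'eq : multiPermGL τ * cellChartGL x hxs = y' := Units.ext (by rw [Units.val_mul, coe_cellChartGL]; exact hy'.symm)
  refine vanishesNearAt_of_archVanishesNear T (multiPermGL τ) hxs (hT _ (by rw [hy'eq]; exact hU'U hy'U') fun hcell => ?_)
  -- on the cell, `relProj x ≠ 0` means the torus components differ
  have hb : piBad v σ (x.1 : Mat) = 0 := (piBad_eq_zero_iff_mem_bruhatCell v σ hτ hxs).2 hcell
  intro heq
  apply hxb
  rw [relProj_eq_zero_iff]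
  refine ⟨hb, ?_⟩
  rw [placeEmbC_torus_eq_cellDiag v σ hτ hxs hb, placeEmbC_torus_eq_cellDiag v σ hτ hxs hb]
  exact heq

/-- **The second-order step on the group.**  Let `T` be a distribution on `GL_n(K_∞)`, an eigendistribution of the
Casimir operators, left and right quasi-invariant under `U_n(K_∞)`; `y` a point of the Bruhat cell `B P_σ B` at the
place `v` whose Bruhat torus coordinates satisfy `t_{σ⁻¹ p₀} = t_{σ⁻¹ p₁}` (`p₀ ≠ p₁`).  If `T` vanishes near every
point near `y` that is off the cell or has `t_{σ⁻¹ p₀} ≠ t_{σ⁻¹ p₁}`, then `T` vanishes near `y`.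
[cite: Shalika1974, §2, Thm. 2.1] -/
theorem archVanishesNear_of_secondOrder {T : ↥(archTestFunctions n K) →ₗ[ℂ] ℂ} (hT : IsArchDistribution n K T)
    (hC : IsArchCasimirEigendistribution n K T)
    (hL : ∀ (u : ↥(upperUnitriangular (Fin n) (mixedSpace K))) (f : ↥(archTestFunctions n K)),
      T (archTestFunctions.leftTranslate (u : G∞) f) = archWhittakerChar n K u * T f)
    (hR : ∀ (u : ↥(upperUnitriangular (Fin n) (mixedSpace K))) (f : ↥(archTestFunctions n K)),
      T (archTestFunctions.rightTranslate (u : G∞) f) = (archWhittakerChar n K u)⁻¹ * T f)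
    {y : G∞} (hy : placeGL v y ∈ bruhatCell (K := ℂ) σ) (hp : p₀ ≠ p₁)
    (hrel : cellDiag σ (placeGL v y) (σ.symm p₀) = cellDiag σ (placeGL v y) (σ.symm p₁))
    (hoff : ∃ U ∈ 𝓝 y, ∀ y' ∈ U,
      (placeGL v y' ∈ bruhatCell (K := ℂ) σ → cellDiag σ (placeGL v y') (σ.symm p₀) ≠ cellDiag σ (placeGL v y') (σ.symm p₁)) →
        ArchVanishesNear T y') :
    ArchVanishesNear T y := by
  -- a chart adapted to `y` at every place, with `σ'_v = σ`
  set σ' : PlaceIdx K → Equiv.Perm (Fin n) := fun v' => if v' = v then σ else (exists_mem_bruhatCell (placeGL v' y)).choose with hσ'def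
  have hσ'v : σ' v = σ := by simp [hσ'def]
  have hσ' : ∀ v', placeGL v' y ∈ bruhatCell (K := ℂ) (σ' v') := by
    intro v'
    by_cases h : v' = v
    · subst h; rw [hσ'v]; exact hy
    · simp only [hσ'def, h, if_false]; exact (exists_mem_bruhatCell (placeGL v' y)).choose_spec
  set τ' : PlaceIdx K → Equiv.Perm (Fin n) := fun v' => Fin.revPerm * σ' v' with hτ'def
  have hτ' : ∀ v', τ' v' = Fin.revPerm * σ' v' := fun _ => rfl
  have hτ'v : τ' v = Fin.revPerm * σ := by rw [hτ', hσ'v]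
  have hbig : (((multiPermGL τ' : G∞)⁻¹ * y : G∞) : Mat) ∈ bruhatBigCell n R∞ := inv_multiPermGL_mul_mem_bruhatBigCell y σ' hσ'
  obtain ⟨e, he, hye⟩ := exists_chart_point hbig
  -- `e` is adapted at every place
  have hgood : ∀ v', piBad v' (σ' v') (e.1 : Mat) = 0 := fun v' =>
    (projB_eq_zero_iff v' (σ' v') e).1 (projB_eq_zero_of_mem_bruhatCell v' (σ' v') (hτ' v') he (by rw [hye]; exact hσ' v'))
  have hadapt : (multiPermGL τ' : G∞) * unitri (e.1 : Mat) e.1.2 * (multiPermGL τ')⁻¹ ∈ upperUnitriangular (Fin n) R∞ :=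
    conj_unitri_mem_upperUnitriangular hτ' e.1.2 hgood
  -- the torus relation in the chart
  have hb : piBad v σ (e.1 : Mat) = 0 := by rw [← hσ'v]; exact hgood v
  have hrel' : placeEmbC v (e.2.1 p₀) = placeEmbC v (e.2.1 p₁) := by
    rw [placeEmbC_torus_eq_cellDiag v σ hτ'v he hb, placeEmbC_torus_eq_cellDiag v σ hτ'v he hb, hye]
    exact hrel
  -- the off-locus vanishing in the chart `τ'`
  have hvan := exists_nhds_vanishesNearAt_of_group_rel v σ p₀ p₁ (T := T) hτ'v he (by rw [hye]; exact hoff)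
  have h := vanishesNearAt_of_secondOrder v σ p₀ p₁ hT hC hL hR hτ'v he hadapt hp hrel' hvan
  rw [← hye]
  exact archVanishesNear_of_vanishesNearAt T (multiPermGL τ') he h

end Group

end Literature.NumberTheory.Automorphic
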